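import Literature.AlgebraicGeometry.Motives.AbelianVarietyBrauerRelationDeflation
import Literature.AlgebraicGeometry.Motives.AbelianVarietyBrauerRelationInflation
import HarnessLib

/-!
# GASSMANN PAIRS PASS TO QUOTIENTS: if `H₁, H₂ ≤ G` have the same permutation character and `N ◁ G`, then so do
# `NH₁, NH₂ ≤ G` and the images `H̄₁, H̄₂ ≤ G/N`; hence `B_{NH₁} ∼ B_{NH₂}` for every `G`-action and
# `B_{H̄₁} ∼ B_{H̄₂}` for every `G/N`-action on an abelian variety — ALGEBRAIC carrier, Hom counts over an arbitrary
# field, isogeny and dimensions over a perfect field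

Layer A1/A2 of the Hodge foundations lane (`lit-hodgefound`, row A1-20⁺ · A2, seat p03 generation 25, row g25-#11) on
the ALGEBRAIC carrier `AbelianVariety K` of `Motives/AbelianVariety`; sequel of
`Motives/AbelianVarietyBrauerRelationDeflation` (CONSUMED: `sum_sum_normal_mul_eq_card_inf_smul`
(`Σ_{h∈H} Σ_{n∈N} f(nh) = |N ∩ H| Σ_{NH} f`), `sum_normal_mul_conj_eq` (the `N`-average of a class function is a class
function)), `Motives/AbelianVarietyBrauerRelationInflation` (CONSUMED: `card_conj_mem_comap_mk_eq`
(`m_{π⁻¹K}(g) = |N| m_K(πg)`), `card_isConj_eq_of_card_conj_mem_eq`, `isIsogenous_of_card_conj_mem_eq`) and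
`Motives/AbelianVarietyBrauerRelationIsogenies` (CONSUMED: `card_mul_sum_eq_of_gassmann`,
`card_conj_mem_eq_of_gassmann`, `finrank_hom_image_eq_of_gassmann`).  Prasad: "It is useful to note that if
`(G, H_1, H_2)` is a Gassmann triple, and if `N` is a normal subgroup of `G`, then `(G/N, H'_1, H'_2)` is a Gassmann
triple in `G/N` where `H_i'` is the image of `H_i` in `G/N`."  The proof: Gassmann equivalence of `H₁`, `H₂` means
`Σ_{H₁} f = Σ_{H₂} f` for every class function `f`; apply it to `1_N` (so `|N ∩ H₁| = |N ∩ H₂|`) and to the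
`N`-average `f̃(g) = Σ_{n∈N} f(ng)` of a class function `f` (so `|N ∩ H_i| Σ_{NH_i} f` agree, hence `Σ_{NH₁} f =
Σ_{NH₂} f`), then to `f = 1_{g^G}`; the quotient form follows from `m_{π⁻¹H̄}(g) = |N| · m_{H̄}(πg)` and
`π⁻¹H̄ = NH`.  Everything is PROVED; the file introduces NO definition and NO named fact (net Literature debt 0).

## Sources, verbatim

D. Prasad, *A refined notion of arithmetically equivalent number fields, and curves with isomorphic Jacobians*,
Adv. Math. **312** (2017) 198–208 (arXiv 1409.3173, held text `paper:arxiv-1409.3173`), Introduction (p0002):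
"Call a triple of finite groups `(G, H_1, H_2)` with `H_1` and `H_2` subgroups of `G`, a Gassmann triple, if
`ℚ[G/H_1]` and `ℚ[G/H_2]` are isomorphic as `G`-modules but `H_1` and `H_2` are not conjugate in `G`. […] It is
useful to note that if `(G, H_1, H_2)` is a Gassmann triple, and if `N` is a normal subgroup of `G`, then
`(G/N, H'_1, H'_2)` is a Gassmann triple in `G/N` where `H_i'` is the image of `H_i` in `G/N`."

A. Bartel, T. Dokchitser, *Brauer relations in finite groups*, JEMS **17** (2015), arXiv 1103.2047 (held
`paper:arxiv-1103.2047`), §2 (p0006): "Projection (or deflation). If `N ◁ G`, then `NΘ = Σ_i NH_i` is a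
`G/N`-relation."  D. Prasad, C. S. Rajan, arXiv:math/0203295, §2 ("`|C ∩ H_1| = |C ∩ H_2|` for all conjugacy classes
`C`"), Cor. 4; E. Kani, M. Rosen, Math. Ann. 284 (1989), Thm. 3.

## Dictionary and what is proved

`G` finite, `N ◁ G`, `H₁, H₂ ≤ G`; `π : G → G/N`; `NH = N ⊔ H`; `H̄ = π(H) = Subgroup.map π H`; marks
`m_H(g) = |{x : x⁻¹gx ∈ H}|`; Gassmann equivalence `|g^G ∩ H₁| = |g^G ∩ H₂|` (`Nat.card {h : H_i // IsConj g h}`).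

* §1 `sum_eq_of_gassmann` (`Σ_{H₁} f = Σ_{H₂} f` for class functions), `sum_boole_mem_eq_card_inf`
  (`Σ_{h∈H} 1_N(h) = |N ∩ H|`), **`card_inf_eq_of_gassmann`** (`|N ∩ H₁| = |N ∩ H₂|`), **`sum_sup_eq_of_gassmann`**
  (`Σ_{NH₁} f = Σ_{NH₂} f` for class functions), `sum_boole_isConj_eq_card` (`Σ_{k∈K} 1_{g^G}(k) = |g^G ∩ K|`),
  **`card_isConj_sup_eq_of_gassmann`** (`|g^G ∩ NH₁| = |g^G ∩ NH₂|`: `NH₁`, `NH₂` are Gassmann equivalent),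
  **`card_conj_mem_sup_eq_of_card_conj_mem_eq`** (equal marks for `H₁, H₂` ⟹ equal marks for `NH₁, NH₂`),
  **`card_conj_mem_map_mk_eq_of_card_conj_mem_eq`** (⟹ equal marks for `H̄₁, H̄₂` in `G/N`: "`(G/N, H'_1, H'_2)` is
  a Gassmann triple").
* §2 (any field) **`finrank_hom_image_sup_eq_of_card_conj_mem_eq`** (`rk Hom(B_{NH₁}, B) = rk Hom(B_{NH₂}, B)`);
  (perfect field) **`isIsogenous_sup_of_card_conj_mem_eq`** (`B_{NH₁} ∼ B_{NH₂}`), **`dim_sup_eq_of_card_conj_mem_eq`**,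
  and for an action of `G/N`: **`isIsogenous_map_mk_of_card_conj_mem_eq`** (`B_{H̄₁} ∼ B_{H̄₂}`),
  **`dim_map_mk_eq_of_card_conj_mem_eq`**.

Scope (stated, not hidden). (1) "Gassmann triple" in the quotation includes NON-CONJUGACY of `H'_1, H'_2`, which
does NOT pass to quotients in general (`N = G`); formalised here is the representation-theoretic half — equality of
permutation characters — which does.  (2) Hom counts over ANY field; isogeny and dimensions over a PERFECT field.

## References

* [Prasad2017] D. Prasad, Adv. Math. 312 (2017) 198–208, arXiv:1409.3173, Introduction.
* [BartelDokchitser2015] A. Bartel, T. Dokchitser, JEMS 17 (2015), arXiv:1103.2047, §2 (Projection).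
* [PrasadRajan2003] D. Prasad, C. S. Rajan, J. Number Theory 99 (2003), arXiv:math/0203295, §2, Cor. 4.
* [KaniRosen1989] E. Kani, M. Rosen, Math. Ann. 284 (1989) 307–327, Thm. 3.
-/

noncomputable section

universe u

open CategoryTheory CategoryTheory.Limits

namespace Literature.AlgebraicGeometry.Motives

namespace AbelianVariety

/-! ## §1 Gassmann equivalence of `H₁, H₂` deflates to `NH₁, NH₂` and to `H̄₁, H̄₂ ≤ G/N` -/

section GassmannDeflation

variable {G : Type} [Group G] [Fintype G] (N H₁ H₂ : Subgroup G) [Fintype H₁] [Fintype H₂]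

/-- **Gassmann equivalent subgroups give equal sums of every class function**: `Σ_{h∈H₁} f(h) = Σ_{h∈H₂} f(h)`
(cancel `|G|` in `Motives/AbelianVarietyBrauerRelationIsogenies.card_mul_sum_eq_of_gassmann`).
[cite: PrasadRajan2003, Lemma 1 and Cor. 1] -/
theorem sum_eq_of_gassmann
    (hG : ∀ g : G, Nat.card {h : H₁ // IsConj g h} = Nat.card {h : H₂ // IsConj g h}) (f : G → ℤ)
    (hf : ∀ a g, f (a * g * a⁻¹) = f g) : ∑ h : H₁, f h = ∑ h : H₂, f h :=
  mul_left_cancel₀ (by exact_mod_cast Fintype.card_ne_zero) (card_mul_sum_eq_of_gassmann H₁ H₂ hG f hf)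

omit [Fintype G] [Fintype H₁] [Fintype H₂] in
/-- `Σ_{h∈H} 1_N(h) = |N ∩ H|`. [cite: BartelDokchitser2015, §2 (Projection)] -/
theorem sum_boole_mem_eq_card_inf (H : Subgroup G) [Fintype H] [DecidablePred (· ∈ N)] :
    (∑ h : H, if (h : G) ∈ N then (1 : ℤ) else 0) = Nat.card (N ⊓ H : Subgroup G) := by
  rw [Finset.sum_boole]
  congr 1
  rw [← Fintype.card_subtype, ← Nat.card_eq_fintype_card]
  exact Nat.card_congr
    { toFun := fun h ↦ ⟨h.1, Subgroup.mem_inf.2 ⟨h.2, h.1.2⟩⟩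
      invFun := fun k ↦ ⟨⟨k, (Subgroup.mem_inf.1 k.2).2⟩, (Subgroup.mem_inf.1 k.2).1⟩
      left_inv := fun _ ↦ rfl
      right_inv := fun _ ↦ rfl }

variable [N.Normal]

/-- **`|N ∩ H₁| = |N ∩ H₂|`** for Gassmann equivalent `H₁, H₂` and normal `N` (`1_N` is a class function).
[cite: Prasad2017, Introduction ("(G/N, H'_1, H'_2) is a Gassmann triple")] [cite: BartelDokchitser2015, §2 (Projection)] -/
theorem card_inf_eq_of_gassmann
    (hG : ∀ g : G, Nat.card {h : H₁ // IsConj g h} = Nat.card {h : H₂ // IsConj g h}) :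
    Nat.card (N ⊓ H₁ : Subgroup G) = Nat.card (N ⊓ H₂ : Subgroup G) := by
  classical
  have hf : ∀ a g : G, (if a * g * a⁻¹ ∈ N then (1 : ℤ) else 0) = if g ∈ N then 1 else 0 := fun a g ↦ by
    have e : a * g * a⁻¹ ∈ N ↔ g ∈ N :=
      ⟨fun h ↦ by
          have h' := ‹N.Normal›.conj_mem _ h a⁻¹
          rwa [show a⁻¹ * (a * g * a⁻¹) * a⁻¹⁻¹ = g by group] at h',
        fun h ↦ ‹N.Normal›.conj_mem g h a⟩
    simp only [e]
  have h := sum_eq_of_gassmann H₁ H₂ hG (fun g ↦ if g ∈ N then (1 : ℤ) else 0) hf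
  rw [sum_boole_mem_eq_card_inf N H₁, sum_boole_mem_eq_card_inf N H₂] at h
  exact_mod_cast h

/-- **`Σ_{NH₁} f = Σ_{NH₂} f` for every class function `f`**, for Gassmann equivalent `H₁, H₂` and `N ◁ G` — apply
the Gassmann identity to the `N`-average `f̃(g) = Σ_{n∈N} f(ng)` (a class function) and use
`Σ_{h∈H} f̃(h) = |N ∩ H| Σ_{NH} f`, `|N ∩ H₁| = |N ∩ H₂|`.
[cite: BartelDokchitser2015, §2 (Projection)] [cite: Prasad2017, Introduction] -/
theorem sum_sup_eq_of_gassmann [Fintype N] [Fintype (N ⊔ H₁ : Subgroup G)] [Fintype (N ⊔ H₂ : Subgroup G)]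
    (hG : ∀ g : G, Nat.card {h : H₁ // IsConj g h} = Nat.card {h : H₂ // IsConj g h}) (f : G → ℤ)
    (hf : ∀ a g, f (a * g * a⁻¹) = f g) :
    ∑ y : (N ⊔ H₁ : Subgroup G), f y = ∑ y : (N ⊔ H₂ : Subgroup G), f y := by
  have h := sum_eq_of_gassmann H₁ H₂ hG (fun g ↦ ∑ n : N, f (n * g)) fun a g ↦ sum_normal_mul_conj_eq N f hf a g
  rw [sum_sum_normal_mul_eq_card_inf_smul N H₁ f, sum_sum_normal_mul_eq_card_inf_smul N H₂ f,
    card_inf_eq_of_gassmann N H₁ H₂ hG, nsmul_eq_mul, nsmul_eq_mul] at h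
  have hne : ((Nat.card (N ⊓ H₂ : Subgroup G) : ℕ) : ℤ) ≠ 0 := by exact_mod_cast Nat.card_pos.ne'
  exact mul_left_cancel₀ hne h

omit [Fintype G] [Fintype H₁] [Fintype H₂] [N.Normal] in
/-- `Σ_{k∈K} 1_{g^G}(k) = |g^G ∩ K|`. [cite: PrasadRajan2003, §2] -/
theorem sum_boole_isConj_eq_card (K : Subgroup G) [Fintype K] (g : G) [DecidablePred (IsConj g)] :
    (∑ k : K, if IsConj g (k : G) then (1 : ℤ) else 0) = Nat.card {k : K // IsConj g k} := by
  rw [Finset.sum_boole, Nat.card_eq_fintype_card, ← Fintype.card_subtype]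

/-- **`NH₁` and `NH₂` are Gassmann equivalent**: `|g^G ∩ NH₁| = |g^G ∩ NH₂|` for every `g`, whenever
`|g^G ∩ H₁| = |g^G ∩ H₂|` for every `g` and `N ◁ G` (`1_{g^G}` is a class function).
[cite: Prasad2017, Introduction] [cite: BartelDokchitser2015, §2 (Projection)] -/
theorem card_isConj_sup_eq_of_gassmann [Fintype N] [Fintype (N ⊔ H₁ : Subgroup G)]
    [Fintype (N ⊔ H₂ : Subgroup G)]
    (hG : ∀ g : G, Nat.card {h : H₁ // IsConj g h} = Nat.card {h : H₂ // IsConj g h}) (g : G) :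
    Nat.card {h : (N ⊔ H₁ : Subgroup G) // IsConj g h} = Nat.card {h : (N ⊔ H₂ : Subgroup G) // IsConj g h} := by
  classical
  have hf : ∀ a k : G, (if IsConj g (a * k * a⁻¹) then (1 : ℤ) else 0) = if IsConj g k then 1 else 0 :=
    fun a k ↦ by
      have e : IsConj g (a * k * a⁻¹) ↔ IsConj g k :=
        ⟨fun h ↦ h.trans (isConj_iff.2 ⟨a⁻¹, by group⟩), fun h ↦ h.trans (isConj_iff.2 ⟨a, rfl⟩)⟩
      simp only [e]
  have h := sum_sup_eq_of_gassmann N H₁ H₂ hG (fun k ↦ if IsConj g k then (1 : ℤ) else 0) hf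
  rw [sum_boole_isConj_eq_card, sum_boole_isConj_eq_card] at h
  exact_mod_cast h

omit [Fintype H₁] [Fintype H₂] in
/-- **Equal marks deflate**: if `|{x : x⁻¹gx ∈ H₁}| = |{x : x⁻¹gx ∈ H₂}|` for every `g` and `N ◁ G`, then
`|{x : x⁻¹gx ∈ NH₁}| = |{x : x⁻¹gx ∈ NH₂}|` for every `g` — the permutation representations on `G/NH₁`, `G/NH₂`
agree. [cite: Prasad2017, Introduction] [cite: BartelDokchitser2015, §2 (Projection)] -/
theorem card_conj_mem_sup_eq_of_card_conj_mem_eq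
    (hm : ∀ g : G, Nat.card {x : G // x⁻¹ * g * x ∈ H₁} = Nat.card {x : G // x⁻¹ * g * x ∈ H₂}) (g : G) :
    Nat.card {x : G // x⁻¹ * g * x ∈ N ⊔ H₁} = Nat.card {x : G // x⁻¹ * g * x ∈ N ⊔ H₂} := by
  classical
  haveI : Fintype H₁ := Fintype.ofFinite _
  haveI : Fintype H₂ := Fintype.ofFinite _
  exact card_conj_mem_eq_of_gassmann (N ⊔ H₁) (N ⊔ H₂)
    (card_isConj_sup_eq_of_gassmann N H₁ H₂ (card_isConj_eq_of_card_conj_mem_eq H₁ H₂ hm)) g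

omit [Fintype H₁] [Fintype H₂] in
/-- **Prasad's remark — Gassmann pairs pass to the quotient**: if `|{x : x⁻¹gx ∈ H₁}| = |{x : x⁻¹gx ∈ H₂}|` for
every `g ∈ G` and `N ◁ G`, then in `Ḡ = G/N` the images `H̄_i = π(H_i)` satisfy
`|{z : z⁻¹yz ∈ H̄₁}| = |{z : z⁻¹yz ∈ H̄₂}|` for every `y ∈ Ḡ` ("then `(G/N, H'_1, H'_2)` is a Gassmann triple in
`G/N` where `H_i'` is the image of `H_i`"; `π⁻¹H̄ = NH` and `m_{π⁻¹H̄}(g) = |N| m_{H̄}(πg)`).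
[cite: Prasad2017, Introduction] [cite: BartelDokchitser2015, §2 (Projection)] -/
theorem card_conj_mem_map_mk_eq_of_card_conj_mem_eq
    (hm : ∀ g : G, Nat.card {x : G // x⁻¹ * g * x ∈ H₁} = Nat.card {x : G // x⁻¹ * g * x ∈ H₂}) (y : G ⧸ N) :
    Nat.card {z : G ⧸ N // z⁻¹ * y * z ∈ H₁.map (QuotientGroup.mk' N)} =
      Nat.card {z : G ⧸ N // z⁻¹ * y * z ∈ H₂.map (QuotientGroup.mk' N)} := by
  obtain ⟨g, rfl⟩ := QuotientGroup.mk_surjective y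
  have key := card_conj_mem_sup_eq_of_card_conj_mem_eq N H₁ H₂ hm g
  have e : ∀ H : Subgroup G, (H.map (QuotientGroup.mk' N)).comap (QuotientGroup.mk' N) = N ⊔ H := fun H ↦ by
    rw [Subgroup.comap_map_eq, QuotientGroup.ker_mk', sup_comm]
  rw [← e H₁, ← e H₂, card_conj_mem_comap_mk_eq, card_conj_mem_comap_mk_eq] at key
  exact Nat.eq_of_mul_eq_mul_left Nat.card_pos key

end GassmannDeflation

/-! ## §2 `B_{NH₁} ∼ B_{NH₂}` and `B_{H̄₁} ∼ B_{H̄₂}` -/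

section GassmannDeflationAV

variable {K : Type u} [Field K] {X : AbelianVariety K} {G : Type} [Group G] [Fintype G] (ρ : G →* End X)
  (N H₁ H₂ : Subgroup G) [N.Normal] [Fintype (N ⊔ H₁ : Subgroup G)] [Fintype (N ⊔ H₂ : Subgroup G)]
  {N₁ N₂ : X ⟶ X}

/-- **Equal Hom counts for the deflated pair** (any field): if `H₁, H₂ ≤ G` have equal marks and `N ◁ G`, then for
`N_i` with `End.of N_i = Σ_{h ∈ NH_i} ρ h` and every `B`: **`rk Hom(B_{NH₁}, B) = rk Hom(B_{NH₂}, B)`**.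
[cite: Prasad2017, Introduction] [cite: PrasadRajan2003, Cor. 4] [cite: KaniRosen1989, Thm. 3] -/
theorem finrank_hom_image_sup_eq_of_card_conj_mem_eq
    (hm : ∀ g : G, Nat.card {x : G // x⁻¹ * g * x ∈ H₁} = Nat.card {x : G // x⁻¹ * g * x ∈ H₂})
    (hN₁ : End.of N₁ = ∑ h : (N ⊔ H₁ : Subgroup G), ρ h) (hN₂ : End.of N₂ = ∑ h : (N ⊔ H₂ : Subgroup G), ρ h)
    (B : AbelianVariety K) : Module.finrank ℤ (image N₁ ⟶ B) = Module.finrank ℤ (image N₂ ⟶ B) :=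
  finrank_hom_image_eq_of_gassmann ρ (N ⊔ H₁) (N ⊔ H₂)
    (card_isConj_eq_of_card_conj_mem_eq _ _ (card_conj_mem_sup_eq_of_card_conj_mem_eq N H₁ H₂ hm)) hN₁ hN₂ B

variable [PerfectField K]

/-- **Deflated Gassmann pairs give isogenous `B`'s** (perfect field): if `H₁, H₂ ≤ G` have equal marks and
`N ◁ G`, then **`B_{NH₁} ∼ B_{NH₂}`** for every `G`-action ("If `N ◁ G`, then `NΘ = Σ_i NH_i` is a
`G/N`-relation", `Θ = H₁ − H₂`). [cite: BartelDokchitser2015, §2 (Projection)] [cite: Prasad2017, Introduction]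
[cite: PrasadRajan2003, Cor. 4] [cite: KaniRosen1989, Thm. 3] -/
theorem isIsogenous_sup_of_card_conj_mem_eq
    (hm : ∀ g : G, Nat.card {x : G // x⁻¹ * g * x ∈ H₁} = Nat.card {x : G // x⁻¹ * g * x ∈ H₂})
    (hN₁ : End.of N₁ = ∑ h : (N ⊔ H₁ : Subgroup G), ρ h) (hN₂ : End.of N₂ = ∑ h : (N ⊔ H₂ : Subgroup G), ρ h) :
    IsIsogenous (image N₁) (image N₂) :=
  isIsogenous_of_card_conj_mem_eq ρ (N ⊔ H₁) (N ⊔ H₂) (card_conj_mem_sup_eq_of_card_conj_mem_eq N H₁ H₂ hm) hN₁ hN₂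

/-- **Dimensions: `dim B_{NH₁} = dim B_{NH₂}`** (perfect field). [cite: Prasad2017, Introduction] [cite: PrasadRajan2003, Cor. 4] -/
theorem dim_sup_eq_of_card_conj_mem_eq
    (hm : ∀ g : G, Nat.card {x : G // x⁻¹ * g * x ∈ H₁} = Nat.card {x : G // x⁻¹ * g * x ∈ H₂})
    (hN₁ : End.of N₁ = ∑ h : (N ⊔ H₁ : Subgroup G), ρ h) (hN₂ : End.of N₂ = ∑ h : (N ⊔ H₂ : Subgroup G), ρ h) :
    (image N₁).dim = (image N₂).dim :=
  (isIsogenous_sup_of_card_conj_mem_eq ρ N H₁ H₂ hm hN₁ hN₂).dim_eq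

omit [Fintype (N ⊔ H₁ : Subgroup G)] [Fintype (N ⊔ H₂ : Subgroup G)] in
/-- **In the quotient** (perfect field): for an action `ρ̄` of `Ḡ = G/N` on `X` and `H₁, H₂ ≤ G` with equal marks,
**`B_{H̄₁} ∼ B_{H̄₂}`** where `H̄_i = π(H_i)` ("`(G/N, H'_1, H'_2)` is a Gassmann triple in `G/N`").
[cite: Prasad2017, Introduction] [cite: PrasadRajan2003, Cor. 4] [cite: KaniRosen1989, Thm. 3] -/
theorem isIsogenous_map_mk_of_card_conj_mem_eq [Fintype (G ⧸ N)] (ρ' : G ⧸ N →* End X)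
    [Fintype (H₁.map (QuotientGroup.mk' N))] [Fintype (H₂.map (QuotientGroup.mk' N))] {M₁ M₂ : X ⟶ X}
    (hm : ∀ g : G, Nat.card {x : G // x⁻¹ * g * x ∈ H₁} = Nat.card {x : G // x⁻¹ * g * x ∈ H₂})
    (hM₁ : End.of M₁ = ∑ h : H₁.map (QuotientGroup.mk' N), ρ' h)
    (hM₂ : End.of M₂ = ∑ h : H₂.map (QuotientGroup.mk' N), ρ' h) : IsIsogenous (image M₁) (image M₂) :=
  isIsogenous_of_card_conj_mem_eq ρ' _ _ (card_conj_mem_map_mk_eq_of_card_conj_mem_eq N H₁ H₂ hm) hM₁ hM₂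

omit [Fintype (N ⊔ H₁ : Subgroup G)] [Fintype (N ⊔ H₂ : Subgroup G)] in
/-- **Dimensions in the quotient: `dim B_{H̄₁} = dim B_{H̄₂}`** (perfect field). [cite: Prasad2017, Introduction] -/
theorem dim_map_mk_eq_of_card_conj_mem_eq [Fintype (G ⧸ N)] (ρ' : G ⧸ N →* End X)
    [Fintype (H₁.map (QuotientGroup.mk' N))] [Fintype (H₂.map (QuotientGroup.mk' N))] {M₁ M₂ : X ⟶ X}
    (hm : ∀ g : G, Nat.card {x : G // x⁻¹ * g * x ∈ H₁} = Nat.card {x : G // x⁻¹ * g * x ∈ H₂})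
    (hM₁ : End.of M₁ = ∑ h : H₁.map (QuotientGroup.mk' N), ρ' h)
    (hM₂ : End.of M₂ = ∑ h : H₂.map (QuotientGroup.mk' N), ρ' h) : (image M₁).dim = (image M₂).dim :=
  (isIsogenous_map_mk_of_card_conj_mem_eq N H₁ H₂ ρ' hm hM₁ hM₂).dim_eq

end GassmannDeflationAV

end AbelianVariety

end Literature.AlgebraicGeometry.Motives
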